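import Literature.MathematicalPhysics.QuantumFieldTheory.Balaban1983to89.B8TorusShiftLandau
import Literature.MathematicalPhysics.QuantumFieldTheory.Balaban1983to89.B8Thm2TorusBridge
import Literature.MathematicalPhysics.QuantumFieldTheory.Balaban1983to89.B7TranslationCovariance

/-!
# `Balaban1983to89.B8Thm2TorusPeriodic` — [Balaban1985RegularSpaces] THEOREM 2 (p. 83) FOR `Ω_j = T_η`: THE GAUGE TRANSFORMATION IS PERIODIC
# FOR PERIODIC DATA — the PERIODICITY JOINT of the torus supplier closed by route P1 (uniqueness + translation covariance): at every torus member,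
# for `U₀`, `U′` invariant under a fine translation by `Lᵏw` (the torus `T_η` of side `P = N·Lᵏ` read on `ℤᵈ`: `w = N eᵢ`), the unique restricted
# `u` of Theorem 2 and its field `A` are invariant under that translation (sub-row «G-B8-T2S», module M1c of `lit-balaban-p33/T2S-MAP.md`)

statement-level skeleton of published theorems with citation tags; proofs where landed; nothing here is a claim about the
Yang–Mills mass gap

T. Bałaban, *Spaces of regular gauge field configurations on a lattice and gauge fixing conditions*, Commun. Math. Phys. **99** (1985) 75–102
`[Balaban1985RegularSpaces]`: Theorem 2 p. 83 («there exists exactly one gauge transformation u»), (1.29) p. 81, (1.36)–(1.39) pp. 82–83, p. 77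
(«Ω_j = T_η for j = 0,1,…,l»); [Balaban1987RG1] (4.16) p. 285 (translation invariance).  STATUS: published, refereed.

CITATION HEADER (lean-in-tree rule).  Cell `lit-balaban`, seat `lit-balaban-p33` (gen 90), sub-row «G-B8-T2S» ([B8] §3 Theorem 2 torus supplier for
R3 `stmt-QuantumFields-19200`), module M1c.  WHAT IS REPRODUCED: print's «exactly one» on the torus forces the gauge transformation to share the
symmetries of the data; here: `B8Thm2TorusMember.thm2_torus_of_socketsE` (Theorem 2 at the torus members of `zdGF3`, WITH its uniqueness clause) +
the translation covariance of every clause of its conclusion (`B8TorusShiftStencils`, `B8TorusShiftAveraging`, `B8TorusShiftLandau`,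
`B7TranslationCovariance.{mgauge_shiftCfg, logCovIter_shiftCfg}`) ⇒ for data invariant under `t_{Lᵏw}` the translated solution is a solution, hence
equal to the solution.  Kind: theorems only; no `def`, no `… : Prop` fact; no existing module modified.

## WHAT IS CERTIFIED HERE (kernel; axioms `propext` ∕ `Classical.choice` ∕ `Quot.sound`)
* §1 `mlogCfg_univ_shiftCfg` (masked log of translated field), `torus_clauses_shiftCfg` — at a torus member, the five clauses of Theorem 2's conclusion
  ((1.29); (1.36) = `C136`; (1.37) = `C137`; (1.38) = `Landau`; (1.39) = `C139` of `zdGF3 (torusIdx …)`, in their concrete unfolded forms) for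
  `(U₀, U′, u)` imply the same clauses for the translated triple `(t_vU₀, t_vU′, t_vu)`, `v = Lᵏw`;
* §2 **`thm2_torus_periodic_of_socketsE`** — `thm2_torus_of_socketsE` with, in addition, for every `w` with `t_{Lᵏw}U₀ = U₀`, `t_{Lᵏw}U′ = U′`:
  `t_{Lᵏw}u = u` for the produced gauge transformation (hence `t_{Lᵏw}` fixes `U′^{u⁻¹}` and `A = (iη)⁻¹ log U′^{u⁻¹}`); modulo the four knit
  sockets at torus members, exactly as in M2.

## HONEST SCOPE — what is NOT claimed
(i) Nothing of Theorem 2 is re-proved; the sockets remain hypotheses at torus members ([4] Thms 3.1–3.3 at a general background: map M5…).  (ii) The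
descent of the periodic `u` to the `Setup` torus (`B8Thm2SetupTorus` §1–§3) and the pointwise strict members (M4-fine) and `SU(N)`-closure (J-SU) are
not done here.  (iii) `d ≥ 2`, `L ≥ 2`, `𝔸` a C⋆-algebra.  Count-neutral; N05 not discharged; nothing continuum ∕ ℝ⁴ ∕ OS ∕ mass-gap ∕ Clay.
-/

noncomputable section

open NormedSpace

namespace Literature.MathematicalPhysics.QuantumFieldTheory.Balaban1983to89.B8Thm2TorusPeriodic

open B7Prop2Explicit B7Prop1Local B7Eq92Concrete
open B8Ineq132 (InAk BondTouches covDerivFwd)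
open B8Eq119TwistedAxial (Restr129 InAx)
open B8Lemma1NonAbelian (mulCfg)
open B8Eq140Level (SideTouches)
open B8Eq184Proof (cfgExp)
open B8Eq146AExpansion (iEta plaqCovDeriv)
open B8Eq143PlaqExpansion (pdiv)
open B7Prop4GeneralLevels (logCovIter)
open B8Eq138LandauZd (IsLandau138 IsLandau138W logCfg covLap)
open B9Eq340HolderZd (hquot AdmPair)
open B8ScaledSupNorm (msup bondNorm)
open B8Thm4TorusAt (torusLam mem_torusLam_iff)
open B8Thm2TorusAt (Cond135T)
open B8LeafModelZd (ZdIdx)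
open B8LeafModelZdSockP5uE (SockP5uE)
open B8LeafModelZdOfHFP (SockHFP₀ SockHFP)
open B8LeafModelZd3 (zdGF3 SockB9P3 mlogCfg)
open B12Ineq417Flat (shiftCfg shiftCfg_apply)
open B7TranslationCovariance (mgauge_shiftCfg logCovIter_shiftCfg)
open B8Thm2TorusMember (TorusMember torusIdx torusLamb mem_torusLamb_iff thm2_torus_of_socketsE)
open B8Thm2TorusBridge (mlogCfg_univ)
open B8TorusShiftStencils (covDerivFwd_shiftCfg covLap_shiftCfg pdiv_plaqCovDeriv_shiftCfg logCfg_shiftCfg cfgExp_shiftCfg' hquot_shiftCfg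
  admPair_shift_iff msup_shift_univ bondNorm_shiftCfg_univ)
open B8TorusShiftAveraging (restr129_torusLam_shiftCfg)
open B8TorusShiftLandau (isLandau138_torusLam_shiftCfg)

-- the `ℤ^d` sites of `B7Prop1Explicit` are `LSite` here (convention of `B8Thm2TorusAt`).
open B7Prop1Explicit renaming Site → LSite

variable {d : ℕ}

/-! ## §1  The clauses of Theorem 2 at a torus member are translation covariant -/

section Clauses

variable {𝔸 : Type} [CStarAlgebra 𝔸] [Nontrivial 𝔸]

omit [CStarAlgebra 𝔸] [Nontrivial 𝔸] in
/-- At `Ω = ℤᵈ` every bond is a side of a plaquette touching `Ω` (`d ≥ 2`). [cite: Balaban1985RegularSpaces, p.77 (plaquette ∕ bond conventions)] -/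
private theorem sideTouches_univ'' (hd2 : 2 ≤ d) (y : LSite d) (τ : Fin d) : SideTouches (Set.univ : Set (LSite d)) y τ := by
  haveI : Nontrivial (Fin d) := Fin.nontrivial_iff_two_le.mpr hd2
  obtain ⟨κ, hκ⟩ := exists_ne τ
  exact B8Eq140Level.sideTouches_of_bondTouches hκ (Or.inl (Set.mem_univ y))

omit [Nontrivial 𝔸] in
/-- The masked logarithm at `Ω_j = ℤᵈ` of a translated field is the translated masked logarithm. [cite: Balaban1985RegularSpaces, (1.36) p.82 («U₁ = exp iηA»)] -/
theorem mlogCfg_univ_shiftCfg (hd2 : 2 ≤ d) (k : ℕ) (η : ℝ) (v : LSite d) (W : LSite d → Fin d → 𝔸ˣ) :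
    mlogCfg k η (fun _ => (Set.univ : Set (LSite d))) (shiftCfg v W) = shiftCfg v (mlogCfg k η (fun _ => (Set.univ : Set (LSite d))) W) := by
  rw [mlogCfg_univ hd2, mlogCfg_univ hd2, logCfg_shiftCfg]

omit [Nontrivial 𝔸] in
/-- **THE CLAUSES (1.29), (1.36)–(1.39) OF THEOREM 2 AT A TORUS MEMBER ARE TRANSLATION COVARIANT** (concrete forms of the `zdGF3 (torusIdx …)` fields;
`v = Lᵏw`): if they hold for the background `U₀`, the gauge-fixed field `W` and the gauge transformation `u`, they hold for `t_vU₀`, `t_vW`, `t_vu`.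
[cite: Balaban1985RegularSpaces, (1.29) p.81, (1.36)–(1.39) pp.82–83, p.77 («Ω_j = T_η»); Balaban1987RG1, (4.16) p.285] -/
theorem torus_clauses_shiftCfg (hd2 : 2 ≤ d) {L : ℕ} (hL : 1 ≤ L) (k : ℕ) (η β : ℝ) (len : LSite d → ℝ) (B₁ B₂ B s α₁ : ℝ)
    (U₀ W : LSite d → Fin d → 𝔸ˣ) (u : LSite d → 𝔸ˣ) (w : LSite d)
    (hR : Restr129 L k (torusLam k) U₀ u)
    (h136 : (∀ j, j ≤ k → ∀ b ∈ {b : LSite d × Fin d | SideTouches ((fun _ => (Set.univ : Set (LSite d))) j) b.1 b.2},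
        W b.1 b.2 = cfgExp η (logCfg η W) b.1 b.2 ∧ IsSelfAdjoint (logCfg η W b.1 b.2) ∧ ‖logCfg η W b.1 b.2‖ ≤ B₁ * s * ((L : ℝ) ^ j * η)⁻¹) ∧
      msup L k η (-(2 : ℝ)) (fun j (q : Fin d × Fin d × LSite d) => SideTouches ((fun _ => (Set.univ : Set (LSite d))) j) q.2.2 q.2.1)
          (fun q => covDerivFwd η U₀ q.1 (fun z => mlogCfg k η (fun _ => (Set.univ : Set (LSite d))) W z q.2.1) q.2.2) ≤ B₁ * s ∧
      msup L k η (-(2 + β)) (fun j (q : Fin d × Fin d × (LSite d × LSite d)) => q.2.2 ∈ AdmPair η len ∧ q.2.2.1 ∈ (fun _ => (Set.univ : Set (LSite d))) j)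
          (fun q => hquot η β len U₀ (covDerivFwd η U₀ q.1 (fun z => mlogCfg k η (fun _ => (Set.univ : Set (LSite d))) W z q.2.1)) q.2.2) ≤ B₂ * s)
    (h137 : ∀ j, j ≤ k → ∀ c ∈ torusLamb (d := d) k j,
      ‖logCovIter L U₀ (iEta η (mlogCfg k η (fun _ => (Set.univ : Set (LSite d))) W)) j c.1 c.2‖ < 2 * d * L * α₁)
    (hLan : IsLandau138W L k η (Set.univ : Set (LSite d)) (torusLam k) U₀ W)
    (h139 : bondNorm L k η (-(3 : ℝ)) (fun _ => (Set.univ : Set (LSite d)))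
        (fun x μ => pdiv η U₀ (plaqCovDeriv η U₀ (mlogCfg k η (fun _ => (Set.univ : Set (LSite d))) W)) μ x) ≤ B * s ∧
      bondNorm L k η (-(3 : ℝ)) (fun _ => (Set.univ : Set (LSite d)))
        (fun x μ => covLap η U₀ (fun z => mlogCfg k η (fun _ => (Set.univ : Set (LSite d))) W z μ) x) ≤ B * s) :
    Restr129 L k (torusLam k) (shiftCfg (((L : ℤ) ^ k) • w) U₀) (shiftCfg (((L : ℤ) ^ k) • w) u) ∧
    ((∀ j, j ≤ k → ∀ b ∈ {b : LSite d × Fin d | SideTouches ((fun _ => (Set.univ : Set (LSite d))) j) b.1 b.2},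
        shiftCfg (((L : ℤ) ^ k) • w) W b.1 b.2 = cfgExp η (logCfg η (shiftCfg (((L : ℤ) ^ k) • w) W)) b.1 b.2 ∧
          IsSelfAdjoint (logCfg η (shiftCfg (((L : ℤ) ^ k) • w) W) b.1 b.2) ∧
          ‖logCfg η (shiftCfg (((L : ℤ) ^ k) • w) W) b.1 b.2‖ ≤ B₁ * s * ((L : ℝ) ^ j * η)⁻¹) ∧
      msup L k η (-(2 : ℝ)) (fun j (q : Fin d × Fin d × LSite d) => SideTouches ((fun _ => (Set.univ : Set (LSite d))) j) q.2.2 q.2.1)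
          (fun q => covDerivFwd η (shiftCfg (((L : ℤ) ^ k) • w) U₀) q.1
            (fun z => mlogCfg k η (fun _ => (Set.univ : Set (LSite d))) (shiftCfg (((L : ℤ) ^ k) • w) W) z q.2.1) q.2.2) ≤ B₁ * s ∧
      msup L k η (-(2 + β)) (fun j (q : Fin d × Fin d × (LSite d × LSite d)) => q.2.2 ∈ AdmPair η len ∧ q.2.2.1 ∈ (fun _ => (Set.univ : Set (LSite d))) j)
          (fun q => hquot η β len (shiftCfg (((L : ℤ) ^ k) • w) U₀) (covDerivFwd η (shiftCfg (((L : ℤ) ^ k) • w) U₀) q.1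
            (fun z => mlogCfg k η (fun _ => (Set.univ : Set (LSite d))) (shiftCfg (((L : ℤ) ^ k) • w) W) z q.2.1)) q.2.2) ≤ B₂ * s) ∧
    (∀ j, j ≤ k → ∀ c ∈ torusLamb (d := d) k j,
      ‖logCovIter L (shiftCfg (((L : ℤ) ^ k) • w) U₀)
          (iEta η (mlogCfg k η (fun _ => (Set.univ : Set (LSite d))) (shiftCfg (((L : ℤ) ^ k) • w) W))) j c.1 c.2‖ < 2 * d * L * α₁) ∧
    IsLandau138W L k η (Set.univ : Set (LSite d)) (torusLam k) (shiftCfg (((L : ℤ) ^ k) • w) U₀) (shiftCfg (((L : ℤ) ^ k) • w) W) ∧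
    (bondNorm L k η (-(3 : ℝ)) (fun _ => (Set.univ : Set (LSite d)))
        (fun x μ => pdiv η (shiftCfg (((L : ℤ) ^ k) • w) U₀) (plaqCovDeriv η (shiftCfg (((L : ℤ) ^ k) • w) U₀)
          (mlogCfg k η (fun _ => (Set.univ : Set (LSite d))) (shiftCfg (((L : ℤ) ^ k) • w) W))) μ x) ≤ B * s ∧
      bondNorm L k η (-(3 : ℝ)) (fun _ => (Set.univ : Set (LSite d)))
        (fun x μ => covLap η (shiftCfg (((L : ℤ) ^ k) • w) U₀)
          (fun z => mlogCfg k η (fun _ => (Set.univ : Set (LSite d))) (shiftCfg (((L : ℤ) ^ k) • w) W) z μ) x) ≤ B * s) := by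
  set v : LSite d := ((L : ℤ) ^ k) • w with hv
  have hml : mlogCfg k η (fun _ => (Set.univ : Set (LSite d))) (shiftCfg v W) =
      shiftCfg v (mlogCfg k η (fun _ => (Set.univ : Set (LSite d))) W) := mlogCfg_univ_shiftCfg hd2 k η v W
  set A : LSite d → Fin d → 𝔸 := mlogCfg k η (fun _ => (Set.univ : Set (LSite d))) W with hA
  obtain ⟨h136a, h136g, h136h⟩ := h136
  refine ⟨restr129_torusLam_shiftCfg L k U₀ u w hR, ⟨?_, ?_, ?_⟩, ?_, ?_, ?_, ?_⟩
  · -- (1.36)₁: pointwise at the translated bond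
    intro j hj b _
    have h := h136a j hj (b.1 + v, b.2) (sideTouches_univ'' hd2 _ _)
    simpa only [logCfg_shiftCfg, cfgExp_shiftCfg', shiftCfg_apply] using h
  · -- (1.36)₂: the translated family is the family re-indexed by `q ↦ (q.1, q.2.1, q.2.2 + v)`
    have hF : (fun q : Fin d × Fin d × LSite d => covDerivFwd η (shiftCfg v U₀) q.1 (fun z => mlogCfg k η (fun _ => Set.univ) (shiftCfg v W) z q.2.1) q.2.2)
        = fun q => (fun q' : Fin d × Fin d × LSite d => covDerivFwd η U₀ q'.1 (fun z => A z q'.2.1) q'.2.2) (q.1, q.2.1, q.2.2 + v) := by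
      funext q
      rw [hml]
      exact covDerivFwd_shiftCfg η v U₀ q.1 (fun z => A z q.2.1) q.2.2
    rw [hF]
    let σ : (Fin d × Fin d × LSite d) ≃ (Fin d × Fin d × LSite d) :=
      { toFun := fun q => (q.1, q.2.1, q.2.2 + v), invFun := fun q => (q.1, q.2.1, q.2.2 - v),
        left_inv := fun q => by simp, right_inv := fun q => by simp }
    have hσ := msup_shift_univ L k η (-(2 : ℝ)) (fun _ (q : Fin d × Fin d × LSite d) => SideTouches (Set.univ : Set (LSite d)) q.2.2 q.2.1) σ
      (fun _ q => by simp [σ, sideTouches_univ'' hd2]) (fun q' => covDerivFwd η U₀ q'.1 (fun z => A z q'.2.1) q'.2.2)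
    exact (le_of_eq hσ).trans h136g
  · -- (1.36)₃: re-indexed by `q ↦ (q.1, q.2.1, (q.2.2.1 + v, q.2.2.2 + v))`
    have hF : (fun q : Fin d × Fin d × (LSite d × LSite d) => hquot η β len (shiftCfg v U₀)
          (covDerivFwd η (shiftCfg v U₀) q.1 (fun z => mlogCfg k η (fun _ => Set.univ) (shiftCfg v W) z q.2.1)) q.2.2)
        = fun q => (fun q' : Fin d × Fin d × (LSite d × LSite d) => hquot η β len U₀ (covDerivFwd η U₀ q'.1 (fun z => A z q'.2.1)) q'.2.2)
            (q.1, q.2.1, (q.2.2.1 + v, q.2.2.2 + v)) := by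
      funext q
      have hD : covDerivFwd η (shiftCfg v U₀) q.1 (fun z => mlogCfg k η (fun _ => Set.univ) (shiftCfg v W) z q.2.1) =
          shiftCfg v (covDerivFwd η U₀ q.1 (fun z => A z q.2.1)) := by
        funext x
        rw [hml, shiftCfg_apply]
        exact covDerivFwd_shiftCfg η v U₀ q.1 (fun z => A z q.2.1) x
      rw [hD, hquot_shiftCfg]
    rw [hF]
    let σ : (Fin d × Fin d × (LSite d × LSite d)) ≃ (Fin d × Fin d × (LSite d × LSite d)) :=
      { toFun := fun q => (q.1, q.2.1, (q.2.2.1 + v, q.2.2.2 + v)), invFun := fun q => (q.1, q.2.1, (q.2.2.1 - v, q.2.2.2 - v)),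
        left_inv := fun q => by simp, right_inv := fun q => by simp }
    have hσ := msup_shift_univ L k η (-(2 + β))
      (fun _ (q : Fin d × Fin d × (LSite d × LSite d)) => q.2.2 ∈ AdmPair η len ∧ q.2.2.1 ∈ (Set.univ : Set (LSite d))) σ
      (fun _ q => by simp [σ, admPair_shift_iff]) (fun q' => hquot η β len U₀ (covDerivFwd η U₀ q'.1 (fun z => A z q'.2.1)) q'.2.2)
    exact (le_of_eq hσ).trans h136h
  · -- (1.37): `Q_k` of translated data at the bond `c` is `Q_k` of the data at `c + w` (all top-lattice bonds are constraint bonds)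
    intro j hj c hc
    have hjk : j = k := (mem_torusLamb_iff k j c).1 hc
    subst hjk
    have hι : iEta η (mlogCfg j η (fun _ => (Set.univ : Set (LSite d))) (shiftCfg v W)) = shiftCfg v (iEta η A) := by
      rw [hml]; rfl
    rw [hι, hv, ← logCovIter_shiftCfg]
    exact h137 j hj (c.1 + w, c.2) ((mem_torusLamb_iff j j _).2 rfl)
  · -- (1.38)
    have h' : IsLandau138 L k η (Set.univ : Set (LSite d)) (torusLam k) U₀ (logCfg η W) := hLan
    have h'' := isLandau138_torusLam_shiftCfg hL k η U₀ (logCfg η W) w h'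
    rw [← logCfg_shiftCfg] at h''
    exact h''
  · -- (1.39)₁
    have hF : (fun x μ => pdiv η (shiftCfg v U₀) (plaqCovDeriv η (shiftCfg v U₀) (mlogCfg k η (fun _ => Set.univ) (shiftCfg v W))) μ x) =
        shiftCfg v (fun x μ => pdiv η U₀ (plaqCovDeriv η U₀ A) μ x) := by
      funext x μ
      rw [hml, shiftCfg_apply]
      exact pdiv_plaqCovDeriv_shiftCfg η v U₀ A μ x
    rw [hF, bondNorm_shiftCfg_univ]
    exact h139.1
  · -- (1.39)₂
    have hF : (fun x μ => covLap η (shiftCfg v U₀) (fun z => mlogCfg k η (fun _ => Set.univ) (shiftCfg v W) z μ) x) =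
        shiftCfg v (fun x μ => covLap η U₀ (fun z => A z μ) x) := by
      funext x μ
      rw [hml, shiftCfg_apply]
      exact covLap_shiftCfg η v U₀ (fun z => A z μ) x
    rw [hF, bondNorm_shiftCfg_univ]
    exact h139.2

end Clauses

/-! ## §2  Theorem 2 at the torus members with a PERIODIC gauge transformation for periodic data -/

section Periodic

variable {𝔸 : Type} [CStarAlgebra 𝔸] [Nontrivial 𝔸]

/-- **THEOREM 2 (p. 83) AT EVERY TORUS MEMBER, WITH THE PERIODICITY OF THE GAUGE TRANSFORMATION FOR PERIODIC DATA** —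
`B8Thm2TorusMember.thm2_torus_of_socketsE` verbatim plus: for every `w` such that the fine translation `t_{Lᵏw}` fixes `U₀` and `U′`, it fixes the
produced `u` (print's «exactly one»: the translated `u` satisfies (1.29), (1.36)–(1.39) for the same data — `torus_clauses_shiftCfg` — hence equals `u`).
Modulo the four knit sockets at torus members, as there. [cite: Balaban1985RegularSpaces, Thm 2 p.83 («exactly one gauge transformation u»), (1.29) p.81, (1.36)–(1.39) pp.82–83, p.77 («Ω_j = T_η»)] -/
theorem thm2_torus_periodic_of_socketsE (hd2 : 2 ≤ d) {L : ℕ} (hL : 2 ≤ L) {β : ℝ} {len : LSite d → ℝ}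
    {B₀ B₀' B₀β cu cF₀ cF cu' cB9 : ℝ} (hB₀ : 0 < B₀) (hB₀' : 0 < B₀') (hB₀β : 0 < B₀β) (hB : 2 ≤ 5 * (d : ℝ) * L * B₀)
    (hcu : 0 < cu) (hcF₀ : 0 < cF₀) (hcF : 0 < cF) (hcu' : 0 < cu') (hcB9 : 0 < cB9)
    (SHFP₀ : ∀ t : TorusMember, SockHFP₀ (𝔸 := 𝔸) L B₀ B₀' cF₀ (torusIdx (d := d) (le_trans one_le_two hL) t).η
      (torusIdx (d := d) (le_trans one_le_two hL) t).k (torusIdx (d := d) (le_trans one_le_two hL) t).Ω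
      (torusIdx (d := d) (le_trans one_le_two hL) t).Λs)
    (SHFP : ∀ t : TorusMember, SockHFP (𝔸 := 𝔸) L B₀ B₀' cF (torusIdx (d := d) (le_trans one_le_two hL) t).η
      (torusIdx (d := d) (le_trans one_le_two hL) t).k (torusIdx (d := d) (le_trans one_le_two hL) t).Ω
      (torusIdx (d := d) (le_trans one_le_two hL) t).Λs)
    (SP5u : ∀ t : TorusMember, SockP5uE (𝔸 := 𝔸) L B₀ cu' cu (torusIdx (d := d) (le_trans one_le_two hL) t).η
      (torusIdx (d := d) (le_trans one_le_two hL) t).k (torusIdx (d := d) (le_trans one_le_two hL) t).Ω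
      (torusIdx (d := d) (le_trans one_le_two hL) t).Λs)
    (SB9all : ∀ t : TorusMember, ∀ m, m ≤ (torusIdx (d := d) (le_trans one_le_two hL) t).k →
      SockB9P3 (𝔸 := 𝔸) L B₀ B₀β cB9 β len (torusIdx (d := d) (le_trans one_le_two hL) t).η m
        (torusIdx (d := d) (le_trans one_le_two hL) t).Ω (torusIdx (d := d) (le_trans one_le_two hL) t).Λs
        (torusIdx (d := d) (le_trans one_le_two hL) t).Λb) :
    ∃ B₁ B₂ c₁ : ℝ, 0 < B₁ ∧ 0 < B₂ ∧ 0 < c₁ ∧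
      ∀ t : TorusMember,
        ∀ α₀ α₁ : ℝ, 0 < α₀ → 0 < α₁ → α₀ + α₁ ≤ c₁ →
          ∀ (U₀ : (zdGF3 𝔸 L β len (torusIdx (d := d) (le_trans one_le_two hL) t)).Cfg)
            (P : (zdGF3 𝔸 L β len (torusIdx (d := d) (le_trans one_le_two hL) t)).Pert),
            (zdGF3 𝔸 L β len (torusIdx (d := d) (le_trans one_le_two hL) t)).InA α₀ U₀ →
            (zdGF3 𝔸 L β len (torusIdx (d := d) (le_trans one_le_two hL) t)).Reg335 α₀ U₀ →
            (zdGF3 𝔸 L β len (torusIdx (d := d) (le_trans one_le_two hL) t)).InAAx α₀ U₀ P →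
            (∀ j, j ≤ t.k → ∀ (z : LSite d) (μ : Fin d), BondTouches (torusLam (d := d) t.k j) z μ →
              (∀ x, InBox (loK L j z) (bondHiK L j z μ) x → x ∈ (Set.univ : Set (LSite d))) →
              ‖(avgIter L (mulCfg P.2.1 U₀.1) j z μ : 𝔸) - (avgIter L U₀.1 j z μ : 𝔸)‖ ≤ α₁) →
            ∃ u : (zdGF3 𝔸 L β len (torusIdx (d := d) (le_trans one_le_two hL) t)).GT,
              (zdGF3 𝔸 L β len (torusIdx (d := d) (le_trans one_le_two hL) t)).Restricted U₀ u ∧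
              (∀ w : LSite d, shiftCfg (((L : ℤ) ^ t.k) • w) U₀.1 = U₀.1 → shiftCfg (((L : ℤ) ^ t.k) • w) P.2.1 = P.2.1 →
                shiftCfg (((L : ℤ) ^ t.k) • w) u.1 = u.1) ∧
              ((zdGF3 𝔸 L β len (torusIdx (d := d) (le_trans one_le_two hL) t)).C136 B₁ B₂ (α₀ + (11 * (d : ℝ) ^ 2 * α₀ + α₁)) U₀
                  ((zdGF3 𝔸 L β len (torusIdx (d := d) (le_trans one_le_two hL) t)).act P u) ∧
                (zdGF3 𝔸 L β len (torusIdx (d := d) (le_trans one_le_two hL) t)).C137 α₁ U₀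
                  ((zdGF3 𝔸 L β len (torusIdx (d := d) (le_trans one_le_two hL) t)).act P u) ∧
                (zdGF3 𝔸 L β len (torusIdx (d := d) (le_trans one_le_two hL) t)).Landau U₀
                  ((zdGF3 𝔸 L β len (torusIdx (d := d) (le_trans one_le_two hL) t)).act P u) ∧
                (zdGF3 𝔸 L β len (torusIdx (d := d) (le_trans one_le_two hL) t)).C139 B₁ (α₀ + (11 * (d : ℝ) ^ 2 * α₀ + α₁)) U₀
                  ((zdGF3 𝔸 L β len (torusIdx (d := d) (le_trans one_le_two hL) t)).act P u)) ∧
              ∀ u' : (zdGF3 𝔸 L β len (torusIdx (d := d) (le_trans one_le_two hL) t)).GT,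
                (zdGF3 𝔸 L β len (torusIdx (d := d) (le_trans one_le_two hL) t)).Restricted U₀ u' →
                (zdGF3 𝔸 L β len (torusIdx (d := d) (le_trans one_le_two hL) t)).C136 B₁ B₂ (α₀ + (11 * (d : ℝ) ^ 2 * α₀ + α₁)) U₀
                  ((zdGF3 𝔸 L β len (torusIdx (d := d) (le_trans one_le_two hL) t)).act P u') →
                (zdGF3 𝔸 L β len (torusIdx (d := d) (le_trans one_le_two hL) t)).C137 α₁ U₀
                  ((zdGF3 𝔸 L β len (torusIdx (d := d) (le_trans one_le_two hL) t)).act P u') →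
                (zdGF3 𝔸 L β len (torusIdx (d := d) (le_trans one_le_two hL) t)).Landau U₀
                  ((zdGF3 𝔸 L β len (torusIdx (d := d) (le_trans one_le_two hL) t)).act P u') →
                (zdGF3 𝔸 L β len (torusIdx (d := d) (le_trans one_le_two hL) t)).C139 B₁ (α₀ + (11 * (d : ℝ) ^ 2 * α₀ + α₁)) U₀
                  ((zdGF3 𝔸 L β len (torusIdx (d := d) (le_trans one_le_two hL) t)).act P u') →
                  u' = u := by
  have hL1 : 1 ≤ L := le_trans one_le_two hL
  obtain ⟨B₁, B₂, c₁, hB₁, hB₂, hc₁, H⟩ :=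
    thm2_torus_of_socketsE (𝔸 := 𝔸) (β := β) (len := len) hd2 hL hB₀ hB₀' hB₀β hB hcu hcF₀ hcF hcu' hcB9 SHFP₀ SHFP SP5u SB9all
  refine ⟨B₁, B₂, c₁, hB₁, hB₂, hc₁, fun t α₀ α₁ hα₀ hα₁ hs U₀ P hInA hReg hInAAx havg => ?_⟩
  obtain ⟨u, hR, hcl, huniq⟩ := H t α₀ α₁ hα₀ hα₁ hs U₀ P hInA hReg hInAAx havg
  refine ⟨u, hR, ?_, hcl, huniq⟩
  intro w hU₀ hU'
  obtain ⟨hP1, -, -⟩ := hInAAx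
  subst hP1
  set v : LSite d := ((L : ℤ) ^ t.k) • w with hv
  -- the translated gauge transformation
  let ut : (zdGF3 𝔸 L β len (torusIdx (d := d) hL1 t)).GT :=
    ⟨shiftCfg v u.1, fun x => u.2.1 (x + v), fun x hx => (hx (Set.mem_univ x)).elim⟩
  have hval : (ut.1 : LSite d → 𝔸ˣ) = shiftCfg v u.1 := rfl
  suffices hut : ut = u by
    have h := congrArg Subtype.val hut
    exact h
  obtain ⟨h136, h137, hLan, h139⟩ := hcl
  -- concrete readings of the clauses for `u`
  set W : LSite d → Fin d → 𝔸ˣ := mgauge P.1.1 u.1⁻¹ P.2.1 with hW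
  have hR' : Restr129 L t.k (torusLam t.k) P.1.1 u.1 := hR
  have h136' : (∀ j, j ≤ t.k → ∀ b ∈ {b : LSite d × Fin d | SideTouches ((fun _ => (Set.univ : Set (LSite d))) j) b.1 b.2},
        W b.1 b.2 = cfgExp t.η (logCfg t.η W) b.1 b.2 ∧ IsSelfAdjoint (logCfg t.η W b.1 b.2) ∧
          ‖logCfg t.η W b.1 b.2‖ ≤ B₁ * (α₀ + (11 * (d : ℝ) ^ 2 * α₀ + α₁)) * ((L : ℝ) ^ j * t.η)⁻¹) ∧
      msup L t.k t.η (-(2 : ℝ)) (fun j (q : Fin d × Fin d × LSite d) => SideTouches ((fun _ => (Set.univ : Set (LSite d))) j) q.2.2 q.2.1)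
          (fun q => covDerivFwd t.η P.1.1 q.1 (fun z => mlogCfg t.k t.η (fun _ => (Set.univ : Set (LSite d))) W z q.2.1) q.2.2)
          ≤ B₁ * (α₀ + (11 * (d : ℝ) ^ 2 * α₀ + α₁)) ∧
      msup L t.k t.η (-(2 + β)) (fun j (q : Fin d × Fin d × (LSite d × LSite d)) => q.2.2 ∈ AdmPair t.η len ∧ q.2.2.1 ∈ (fun _ => (Set.univ : Set (LSite d))) j)
          (fun q => hquot t.η β len P.1.1 (covDerivFwd t.η P.1.1 q.1 (fun z => mlogCfg t.k t.η (fun _ => (Set.univ : Set (LSite d))) W z q.2.1)) q.2.2)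
          ≤ B₂ * (α₀ + (11 * (d : ℝ) ^ 2 * α₀ + α₁)) := h136
  have h137' : ∀ j, j ≤ t.k → ∀ c ∈ torusLamb (d := d) t.k j,
      ‖logCovIter L P.1.1 (iEta t.η (mlogCfg t.k t.η (fun _ => (Set.univ : Set (LSite d))) W)) j c.1 c.2‖ < 2 * d * L * α₁ := h137
  have hLan' : IsLandau138W L t.k t.η (Set.univ : Set (LSite d)) (torusLam t.k) P.1.1 W := hLan
  have h139' : bondNorm L t.k t.η (-(3 : ℝ)) (fun _ => (Set.univ : Set (LSite d)))
        (fun x μ => pdiv t.η P.1.1 (plaqCovDeriv t.η P.1.1 (mlogCfg t.k t.η (fun _ => (Set.univ : Set (LSite d))) W)) μ x)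
          ≤ B₁ * (α₀ + (11 * (d : ℝ) ^ 2 * α₀ + α₁)) ∧
      bondNorm L t.k t.η (-(3 : ℝ)) (fun _ => (Set.univ : Set (LSite d)))
        (fun x μ => covLap t.η P.1.1 (fun z => mlogCfg t.k t.η (fun _ => (Set.univ : Set (LSite d))) W z μ) x)
          ≤ B₁ * (α₀ + (11 * (d : ℝ) ^ 2 * α₀ + α₁)) := h139
  -- the translated clauses, read back at the ORIGINAL (periodic) data
  obtain ⟨hRt, h136t, h137t, hLant, h139t⟩ :=
    torus_clauses_shiftCfg hd2 hL1 t.k t.η β len B₁ B₂ B₁ (α₀ + (11 * (d : ℝ) ^ 2 * α₀ + α₁)) α₁ P.1.1 W u.1 w hR' h136' h137' hLan' h139'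
  have hWt : mgauge P.1.1 (shiftCfg v u.1)⁻¹ P.2.1 = shiftCfg v W := by
    have h := mgauge_shiftCfg v P.1.1 u.1⁻¹ P.2.1
    rw [hU₀, hU'] at h
    exact h
  rw [hU₀] at hRt h136t h137t hLant h139t
  rw [← hWt] at h136t h137t hLant h139t
  exact huniq ut hRt h136t h137t hLant h139t

end Periodic

#print axioms torus_clauses_shiftCfg
#print axioms thm2_torus_periodic_of_socketsE

end Literature.MathematicalPhysics.QuantumFieldTheory.Balaban1983to89.B8Thm2TorusPeriodic

end
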